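import Mathlib.Combinatorics.SimpleGraph.Hamiltonian
import Mathlib.Combinatorics.SimpleGraph.CycleGraph
import Mathlib.Dynamics.PeriodicPts.Lemmas
import Mathlib.Tactic.FinCases
import Mathlib.Tactic.NormNum
import Literature.Barriers.PneNP.TSPExtensionComplexityTours
import HarnessLib

/-!
# Hamiltonian cycles as cyclic vertex listings; directed cycles via vertex splitting

Support file for the NP-completeness of (UNDIRECTED) HAMILTON CIRCUIT (Karp 1972, Main Theorem,
problem 10; `Literature.Computability.Complexity.isNPComplete_HAMCIRCUIT`), in two parts.

## Part 1. Listings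

Mathlib's `SimpleGraph.IsHamiltonian` is phrased through closed walks (`Walk.IsHamiltonianCycle`);
the reductions and the `NP` verifier reason instead about the CERTIFICATE of Arora–Barak 2009,
Thm. 2.17 ("the ordered list of vertices in the path can serve as a certificate"): a list
visiting every vertex exactly once whose cyclically consecutive entries are adjacent.

* `IsHamCycleListing R l` — `l` is duplicate-free, lists every vertex, and `R l[i] l[(i+1) mod |l|]`
  for every index `i` (a Hamiltonian cycle of the relation `R`, e.g. `G.Adj` for a simple graph or
  the arc relation of a digraph, read as a cyclic sequence);
* `isHamCycleListing_iff_isChain` — the same with `List.IsChain` plus the wrap-around pair;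
* **`isHamiltonian_iff_exists_isHamCycleListing`** — for a finite simple graph,
  `G.IsHamiltonian ↔ card = 1 ∨ ∃ l, 3 ≤ |l| ∧ IsHamCycleListing G.Adj l` (Mathlib's conventions:
  the one-vertex graph is Hamiltonian; a Hamiltonian cycle has length `≥ 3`);
  `isHamiltonian_iff_of_iso` — invariance under graph isomorphisms.

## Part 2. Directed Hamiltonian cycles to undirected ones: the vertex-splitting construction

Combinatorial half of Karp's reduction DIRECTED HAMILTON CIRCUIT ∝ (UNDIRECTED) HAMILTON CIRCUIT
(Karp 1972, Main Theorem, problems 9 and 10), in the form printed by Sipser (Thm. 7.55, for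
paths): "Each node `u` of `G` is replaced by a triple of nodes `u_in`, `u_mid`, `u_out` … edges
connect `u_mid` with `u_in` and `u_out` … an edge connects `u_out` with `v_in` if an edge goes from
`u` to `v` in `G`."

For a relation `A` on a finite vertex type `V` (the arcs of a digraph, loops allowed) we define the
simple graph `splitGraph A` on `V × Fin 3` (`(v,0) = v_in`, `(v,1) = v_mid`, `(v,2) = v_out`) and
prove

* **`isHamiltonian_splitGraph_iff`**: `splitGraph A` is Hamiltonian (Mathlib's
  `SimpleGraph.IsHamiltonian`) iff `A` has a directed Hamiltonian cycle, i.e. a nonempty cyclic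
  listing `l` of `V` with `A l[i] l[(i+1) mod |l|]`.

Forward ("a Hamiltonian path `s, u₁, …, u_k, t` has a corresponding path
`s_out, u₁_in, u₁_mid, u₁_out, …`"): the listing `l` is tripled (`triList l`). Backward (Sipser's
claim that any Hamiltonian cycle "must go from a triple of nodes to a triple of nodes"): the
Hamiltonian cycle is read as its edge set `T` (a tour, `Literature.Barriers.PneNP.IsTourOn`);
degree-two forcing at `v_mid` puts both `{v_in, v_mid}`, `{v_mid, v_out}` in `T`, so the second
tour edge at `v_out` goes to some `w_in` with `A v w` — this defines a successor map `next`, which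
is injective (the second tour edge at `w_in` is unique), hence a permutation of the finite `V`;
the tripled orbit of any vertex is a cycle all of whose edges are tour edges, so by subtour
elimination (`IsTourOn.not_cycEdges_subset`) the orbit is all of `V`, and it is the sought
directed Hamiltonian cycle.

All [folklore] / as cited; no named facts.

## References

* R. M. Karp, *Reducibility among combinatorial problems*, in: Complexity of Computer
  Computations (Miller, Thatcher, eds.), Plenum 1972, 85–103, Main Theorem (problems 9, 10:
  DIRECTED HAMILTON CIRCUIT ∝ HAMILTON CIRCUIT).
* M. Sipser, *Introduction to the Theory of Computation*, 3rd ed., Cengage 2012, Thm. 7.55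
  (`HAMPATH ≤ₚ UHAMPATH`, the construction and both directions of its correctness proof).
* S. Arora, B. Barak, *Computational Complexity: A Modern Approach*, CUP 2009, Thm. 2.17 (proof,
  first sentence: the vertex list as certificate), Ex. 2.18 (`HAMCYCLE`).
-/

/-! ## Part 1. Listings -/


namespace Literature.Combinatorics.SimpleGraph

variable {α : Type*}

/-! ### Cyclic listings -/

/-- **`IsHamCycleListing R l`**: the list `l` has no duplicates, contains every element of `α`,
and cyclically consecutive entries are related: `R l[i] l[(i + 1) % |l|]` for all `i < |l|`
(for `|l| = 1` this asks for the loop `R l[0] l[0]`). [cite: AroraBarakCC2009, Thm. 2.17 (proof)] -/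
def IsHamCycleListing (R : α → α → Prop) (l : List α) : Prop :=
  l.Nodup ∧ (∀ v, v ∈ l) ∧
    ∀ (i : ℕ) (hi : i < l.length), R l[i] (l[(i + 1) % l.length]'(Nat.mod_lt _ (Nat.zero_lt_of_lt hi)))

namespace IsHamCycleListing

variable {R : α → α → Prop} {l : List α}

/-- A listing has no duplicates. [folklore] -/
theorem nodup (h : IsHamCycleListing R l) : l.Nodup := h.1

/-- A listing contains every vertex. [folklore] -/
theorem mem (h : IsHamCycleListing R l) (v : α) : v ∈ l := h.2.1 v

/-- Cyclically consecutive entries are related. [folklore] -/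
theorem rel (h : IsHamCycleListing R l) (i : ℕ) (hi : i < l.length) :
    R l[i] (l[(i + 1) % l.length]'(Nat.mod_lt _ (Nat.zero_lt_of_lt hi))) := h.2.2 i hi

/-- Consecutive entries are related. [folklore] -/
theorem rel_succ (h : IsHamCycleListing R l) (i : ℕ) (hi : i + 1 < l.length) :
    R l[i] l[i + 1] := by
  have := h.rel i (by omega)
  simp only [Nat.mod_eq_of_lt hi] at this
  exact this

/-- The wrap-around pair is related. [folklore] -/
theorem rel_last_zero (h : IsHamCycleListing R l) (hl : 0 < l.length) :
    R l[l.length - 1] l[0] := by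
  have := h.rel (l.length - 1) (by omega)
  simp only [Nat.sub_add_cancel hl, Nat.mod_self] at this
  exact this

/-- Over a `Fintype`, a listing has length the number of vertices. [folklore] -/
theorem length_eq [Fintype α] [DecidableEq α] (h : IsHamCycleListing R l) :
    l.length = Fintype.card α := by
  rw [← List.toFinset_card_of_nodup h.nodup, ← Finset.card_univ]
  congr 1
  exact Finset.eq_univ_iff_forall.2 fun v => List.mem_toFinset.2 (h.mem v)

/-- A listing of a nonempty type is nonempty. [folklore] -/
theorem ne_nil [Nonempty α] (h : IsHamCycleListing R l) : l ≠ [] := by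
  obtain ⟨v⟩ := ‹Nonempty α›
  exact List.ne_nil_of_mem (h.mem v)

/-- Monotonicity in the relation. [folklore] -/
theorem mono {R' : α → α → Prop} (hRR' : ∀ a b, R a b → R' a b) (h : IsHamCycleListing R l) :
    IsHamCycleListing R' l :=
  ⟨h.1, h.2.1, fun i hi => hRR' _ _ (h.rel i hi)⟩

end IsHamCycleListing

/-- **Chain form.** `l` is a listing iff it is duplicate-free, exhaustive, an `R`-chain, and its
last entry is related to its first. [folklore] -/
theorem isHamCycleListing_iff_isChain (R : α → α → Prop) (l : List α) :
    IsHamCycleListing R l ↔ l.Nodup ∧ (∀ v, v ∈ l) ∧ List.IsChain R l ∧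
      ∀ hl : l ≠ [], R (l.getLast hl) (l.head hl) := by
  constructor
  · intro h
    refine ⟨h.nodup, h.mem, ?_, fun hl => ?_⟩
    · exact List.isChain_iff_getElem.2 fun i hi => h.rel_succ i hi
    · have h0 : 0 < l.length := List.length_pos_iff.2 hl
      rw [List.getLast_eq_getElem, List.head_eq_getElem]
      exact h.rel_last_zero h0
  · rintro ⟨hnd, hall, hch, hwrap⟩
    refine ⟨hnd, hall, fun i hi => ?_⟩
    by_cases hlast : i + 1 < l.length
    · have := List.isChain_iff_getElem.1 hch i hlast
      simp only [Nat.mod_eq_of_lt hlast]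
      exact this
    · have hl : l ≠ [] := List.ne_nil_of_length_pos (Nat.zero_lt_of_lt hi)
      have hi' : i = l.length - 1 := by omega
      subst hi'
      have h1 : l.length - 1 + 1 = l.length := by omega
      have := hwrap hl
      rw [List.getLast_eq_getElem, List.head_eq_getElem] at this
      simp only [h1, Nat.mod_self]
      exact this

/-! ### Hamiltonian simple graphs -/

section Graphs

open _root_.SimpleGraph

variable [DecidableEq α]

/-- In `Fin (k+3)`, `u + 1` has value `(u + 1) mod (k + 3)`. [folklore] -/
private theorem val_add_one_fin (k : ℕ) (u : Fin (k + 3)) :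
    ((u + 1 : Fin (k + 3)) : ℕ) = ((u : ℕ) + 1) % (k + 3) := by
  rw [Fin.val_add]
  simp

/-- **A listing of length `≥ 3` with adjacent consecutive entries yields a Hamiltonian cycle**
(the cycle `cycleGraph.cycle` of Mathlib's cycle graph mapped along `i ↦ l[i]`, a bijective
graph homomorphism). [cite: AroraBarakCC2009, Thm. 2.17 (proof)] -/
theorem IsHamCycleListing.isHamiltonian [Fintype α] {G : _root_.SimpleGraph α} {l : List α}
    (h : IsHamCycleListing G.Adj l) (h3 : 3 ≤ l.length) : G.IsHamiltonian := by
  intro _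
  obtain ⟨k, hk⟩ : ∃ k, l.length = k + 3 := ⟨l.length - 3, by omega⟩
  let f : Fin (k + 3) → α := fun i => l[(i : ℕ)]'(by omega)
  have hfinj : Function.Injective f := by
    intro i j hij
    exact Fin.ext ((h.nodup.getElem_inj_iff).1 hij)
  have hfsurj : Function.Surjective f := fun v => by
    obtain ⟨i, hi, rfl⟩ := List.getElem_of_mem (h.mem v)
    exact ⟨⟨i, by omega⟩, rfl⟩
  have hf1 : ∀ u : Fin (k + 3),
      f (u + 1) = l[((u : ℕ) + 1) % l.length]'(Nat.mod_lt _ (by omega)) := by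
    intro u
    simp only [f, val_add_one_fin, hk]
  have hadj : ∀ u : Fin (k + 3), G.Adj (f u) (f (u + 1)) := fun u => by
    rw [hf1 u]
    exact h.rel u (by omega)
  let φ : cycleGraph (k + 3) →g G :=
    ⟨f, fun {u w} huw => by
      rcases (cycleGraph_adj (n := k + 1)).1 huw with h1 | h1
      · rw [sub_eq_iff_eq_add'.1 h1]
        exact (hadj w).symm
      · rw [sub_eq_iff_eq_add'.1 h1]
        exact hadj u⟩
  have hcyc : (cycleGraph.cycle k).IsHamiltonianCycle :=
    Walk.isHamiltonianCycle_iff_isCycle_and_length_eq.2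
      ⟨cycleGraph.isCycle_cycle, by simp [cycleGraph.length_cycle]⟩
  exact ⟨φ 0, (cycleGraph.cycle k).map φ, hcyc.map (f := φ) ⟨hfinj, hfsurj⟩⟩

/-- **The vertex list of a Hamiltonian cycle is a listing** (the support of the closed walk
without its repeated start vertex). [cite: AroraBarakCC2009, Thm. 2.17 (proof)] -/
theorem isHamCycleListing_support_tail {G : _root_.SimpleGraph α} {a : α} {p : G.Walk a a}
    (hp : p.IsHamiltonianCycle) : IsHamCycleListing G.Adj p.support.tail := by
  have hnil : ¬p.Nil := hp.isCycle.not_nil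
  have hcount := (Walk.isHamiltonianCycle_iff_isCycle_and_support_count_tail_eq_one.1 hp).2
  rw [isHamCycleListing_iff_isChain]
  refine ⟨?_, ?_, p.isChain_adj_support.tail, fun hl => ?_⟩
  · exact List.nodup_iff_count_le_one.2 fun v => (hcount v).le
  · intro v
    exact List.count_pos_iff.1 (by rw [hcount v]; exact Nat.one_pos)
  · have key : ∀ (m : List α) (hm : m ≠ []), m = p.tail.support →
        G.Adj (m.getLast hm) (m.head hm) := by
      rintro m hm rfl
      rw [Walk.getLast_support, Walk.head_support]
      exact p.adj_snd hnil
    exact key _ hl (p.support_tail_of_not_nil hnil).symm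

/-- The vertex list of a Hamiltonian cycle has length `card α ≥ 3`. [folklore] -/
theorem three_le_length_support_tail [Fintype α] {G : _root_.SimpleGraph α} {a : α}
    {p : G.Walk a a} (hp : p.IsHamiltonianCycle) : 3 ≤ p.support.tail.length := by
  rw [List.length_tail, Walk.length_support, Nat.add_sub_cancel]
  exact hp.isCycle.three_le_length

/-- Hamiltonicity is invariant under graph isomorphisms (map the Hamiltonian cycle along the
isomorphism). [folklore] -/
theorem isHamiltonian_of_iso {β : Type*} [Fintype α] [Fintype β] [DecidableEq β]
    {G : _root_.SimpleGraph α} {H : _root_.SimpleGraph β} (e : G ≃g H) (hG : G.IsHamiltonian) :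
    H.IsHamiltonian := by
  intro hβ
  have hα : Fintype.card α ≠ 1 := by rwa [Fintype.card_congr e.toEquiv]
  obtain ⟨a, p, hp⟩ := hG hα
  exact ⟨e a, p.map e.toRelEmbedding.toRelHom,
    hp.map (f := e.toRelEmbedding.toRelHom) e.toEquiv.bijective⟩

/-- `G ≃g H` ⟹ (`G` Hamiltonian iff `H` Hamiltonian). [folklore] -/
theorem isHamiltonian_iff_of_iso {β : Type*} [Fintype α] [Fintype β] [DecidableEq β]
    {G : _root_.SimpleGraph α} {H : _root_.SimpleGraph β} (e : G ≃g H) :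
    G.IsHamiltonian ↔ H.IsHamiltonian :=
  ⟨isHamiltonian_of_iso e, isHamiltonian_of_iso e.symm⟩

/-- **Hamiltonicity through listings.** A finite simple graph is Hamiltonian (Mathlib: the
one-vertex graph is, by convention) iff it has one vertex or admits a cyclic listing of length at
least `3` with adjacent consecutive entries. [cite: AroraBarakCC2009, Thm. 2.17 (proof) and Ex. 2.18] -/
theorem isHamiltonian_iff_exists_isHamCycleListing [Fintype α] (G : _root_.SimpleGraph α) :
    G.IsHamiltonian ↔
      Fintype.card α = 1 ∨ ∃ l : List α, 3 ≤ l.length ∧ IsHamCycleListing G.Adj l := by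
  constructor
  · intro hG
    by_cases h1 : Fintype.card α = 1
    · exact Or.inl h1
    · obtain ⟨a, p, hp⟩ := hG h1
      exact Or.inr ⟨p.support.tail, three_le_length_support_tail hp,
        isHamCycleListing_support_tail hp⟩
  · rintro (h1 | ⟨l, h3, hl⟩)
    · exact IsHamiltonian.of_card_eq_one h1
    · exact hl.isHamiltonian h3

/-- Listing form over a type with at least three elements: `G.IsHamiltonian ↔ ∃ l,
IsHamCycleListing G.Adj l`. [cite: AroraBarakCC2009, Ex. 2.18] -/
theorem isHamiltonian_iff_of_three_le_card [Fintype α] (G : _root_.SimpleGraph α)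
    (h3 : 3 ≤ Fintype.card α) : G.IsHamiltonian ↔ ∃ l : List α, IsHamCycleListing G.Adj l := by
  rw [isHamiltonian_iff_exists_isHamCycleListing]
  constructor
  · rintro (h1 | ⟨l, -, hl⟩)
    · omega
    · exact ⟨l, hl⟩
  · rintro ⟨l, hl⟩
    exact Or.inr ⟨l, hl.length_eq ▸ h3, hl⟩

end Graphs

end Literature.Combinatorics.SimpleGraph

/-! ## Part 2. The vertex-splitting construction -/

namespace Literature.Combinatorics.SimpleGraph

open _root_.SimpleGraph Literature.Barriers.PneNP Finset Function

variable {V : Type*}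

/-! ### The split graph -/

/-- The (directed) relation generating the split graph: `v_in → v_mid`, `v_mid → v_out`, and
`u_out → w_in` for every arc `A u w`. [cite: Sipser2012, Thm. 7.55 (construction)] -/
def splitRel (A : V → V → Prop) (x y : V × Fin 3) : Prop :=
  (x.1 = y.1 ∧ x.2 = 0 ∧ y.2 = 1) ∨ (x.1 = y.1 ∧ x.2 = 1 ∧ y.2 = 2) ∨ (x.2 = 2 ∧ y.2 = 0 ∧ A x.1 y.1)

/-- **The split graph** of the digraph `A` on `V`: the simple graph on `V × Fin 3` generated
(symmetrised, loops removed) by `splitRel A`. [cite: Sipser2012, Thm. 7.55 (construction)] -/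
def splitGraph (A : V → V → Prop) : _root_.SimpleGraph (V × Fin 3) :=
  SimpleGraph.fromRel (splitRel A)

variable (A : V → V → Prop)

/-- Adjacency in the split graph. [cite: Sipser2012, Thm. 7.55 (construction)] -/
theorem splitGraph_adj_iff (x y : V × Fin 3) :
    (splitGraph A).Adj x y ↔ x ≠ y ∧ (splitRel A x y ∨ splitRel A y x) :=
  SimpleGraph.fromRel_adj _ _ _

/-- `v_in` and `v_mid` are adjacent. [cite: Sipser2012, Thm. 7.55] -/
theorem splitGraph_adj_in_mid (v : V) : (splitGraph A).Adj (v, 0) (v, 1) := by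
  simp [splitGraph_adj_iff, splitRel]

/-- `v_mid` and `v_out` are adjacent. [cite: Sipser2012, Thm. 7.55] -/
theorem splitGraph_adj_mid_out (v : V) : (splitGraph A).Adj (v, 1) (v, 2) := by
  simp [splitGraph_adj_iff, splitRel]

/-- `u_out` and `w_in` are adjacent when `A u w`. [cite: Sipser2012, Thm. 7.55] -/
theorem splitGraph_adj_out_in {u w : V} (h : A u w) : (splitGraph A).Adj (u, 2) (w, 0) := by
  simp [splitGraph_adj_iff, splitRel, h]

/-- The neighbours of `v_mid` are `v_in` and `v_out`. [cite: Sipser2012, Thm. 7.55 (proof)] -/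
theorem splitGraph_adj_mid_iff (v : V) (y : V × Fin 3) :
    (splitGraph A).Adj (v, 1) y ↔ y = (v, 0) ∨ y = (v, 2) := by
  obtain ⟨w, t⟩ := y
  fin_cases t <;> simp [splitGraph_adj_iff, splitRel, eq_comm]

/-- The neighbours of `v_out` are `v_mid` and the `w_in` with `A v w`.
[cite: Sipser2012, Thm. 7.55 (proof)] -/
theorem splitGraph_adj_out_iff (v : V) (y : V × Fin 3) :
    (splitGraph A).Adj (v, 2) y ↔ y = (v, 1) ∨ ∃ w, y = (w, 0) ∧ A v w := by
  obtain ⟨w, t⟩ := y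
  fin_cases t <;> simp [splitGraph_adj_iff, splitRel, eq_comm]

/-- The neighbours of `v_in` are `v_mid` and the `u_out` with `A u v`.
[cite: Sipser2012, Thm. 7.55 (proof)] -/
theorem splitGraph_adj_in_iff (v : V) (y : V × Fin 3) :
    (splitGraph A).Adj (v, 0) y ↔ y = (v, 1) ∨ ∃ u, y = (u, 2) ∧ A u v := by
  obtain ⟨w, t⟩ := y
  fin_cases t <;> simp [splitGraph_adj_iff, splitRel, eq_comm]

/-! ### Tripling a vertex list -/

/-- The tag `i mod 3` as an element of `Fin 3`. [folklore] -/
def tag3 (i : ℕ) : Fin 3 := ⟨i % 3, Nat.mod_lt _ (by decide)⟩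

/-- The value of `tag3 i` is `i mod 3`. [folklore] -/
@[simp] theorem tag3_val (i : ℕ) : (tag3 i : ℕ) = i % 3 := rfl

/-- `tag3 i = 0 ↔ i ≡ 0 (mod 3)`. [folklore] -/
theorem tag3_eq_zero_iff (i : ℕ) : tag3 i = 0 ↔ i % 3 = 0 := by simp [Fin.ext_iff]
/-- `tag3 i = 1 ↔ i ≡ 1 (mod 3)`. [folklore] -/
theorem tag3_eq_one_iff (i : ℕ) : tag3 i = 1 ↔ i % 3 = 1 := by simp [Fin.ext_iff]
/-- `tag3 i = 2 ↔ i ≡ 2 (mod 3)`. [folklore] -/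
theorem tag3_eq_two_iff (i : ℕ) : tag3 i = 2 ↔ i % 3 = 2 := by simp [Fin.ext_iff]

/-- `tag3 (3q + r) = r`. [folklore] -/
theorem tag3_mul_add (q : ℕ) (r : Fin 3) : tag3 (3 * q + r) = r :=
  Fin.ext (by have := r.2; show (3 * q + (r : ℕ)) % 3 = r; omega)

/-- **The tripled list** `[(l₀,0),(l₀,1),(l₀,2),(l₁,0),…]` of a vertex list `l`: the vertex list
of the cycle `u₁_in, u₁_mid, u₁_out, u₂_in, …` of Sipser's proof. [cite: Sipser2012, Thm. 7.55 (proof)] -/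
def triList (l : List V) : List (V × Fin 3) :=
  List.ofFn fun i : Fin (3 * l.length) => (l[(i : ℕ) / 3]'(by omega), tag3 i)

/-- The tripled list has thrice the length. [folklore] -/
@[simp] theorem length_triList (l : List V) : (triList l).length = 3 * l.length := by
  simp [triList]

/-- Entry `i` of the tripled list is `(l[i / 3], i mod 3)`. [folklore] -/
theorem getElem_triList (l : List V) (i : ℕ) (hi : i < (triList l).length) :
    (triList l)[i] = (l[i / 3]'(by rw [length_triList] at hi; omega), tag3 i) := by
  simp [triList]

/-- Every `(v, r)` with `v ∈ l` occurs in `triList l`, at index `3 j + r` if `v = l[j]`.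
[folklore] -/
theorem getElem_triList_mul_add (l : List V) (j : ℕ) (hj : j < l.length) (r : Fin 3) :
    (triList l)[3 * j + (r : ℕ)]'(by rw [length_triList]; omega) = (l[j], r) := by
  rw [getElem_triList]
  have h1 : (3 * j + (r : ℕ)) / 3 = j := by omega
  simp only [h1, tag3_mul_add]

/-- Every `(v, r)` with `v ∈ l` occurs in the tripled list. [folklore] -/
theorem mem_triList {l : List V} {v : V} (hv : v ∈ l) (r : Fin 3) : (v, r) ∈ triList l := by
  obtain ⟨j, hj, rfl⟩ := List.getElem_of_mem hv
  rw [← getElem_triList_mul_add l j hj r]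
  exact List.getElem_mem _

/-- Tripling a duplicate-free list gives a duplicate-free list. [folklore] -/
theorem nodup_triList {l : List V} (hl : l.Nodup) : (triList l).Nodup := by
  rw [triList, List.nodup_ofFn]
  rintro ⟨i, hi⟩ ⟨j, hj⟩ h
  simp only [Prod.mk.injEq, Fin.ext_iff, tag3_val] at h
  obtain ⟨h1, h2⟩ := h
  have h3 : i / 3 = j / 3 := (hl.getElem_inj_iff).1 h1
  exact Fin.ext (by simp only; omega)

/-- **Consecutive pairs of the tripled list.** A property holding for the pairs
`((v,0),(v,1))`, `((v,1),(v,2))` (`v ∈ l`) and `((l_q,2),(l_{(q+1) mod |l|},0))` holds for all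
cyclically consecutive pairs of `triList l`. [folklore] -/
theorem triList_cyclic {l : List V} (P : V × Fin 3 → V × Fin 3 → Prop)
    (h01 : ∀ v ∈ l, P (v, 0) (v, 1)) (h12 : ∀ v ∈ l, P (v, 1) (v, 2))
    (h20 : ∀ (q : ℕ) (hq : q < l.length),
      P (l[q], 2) (l[(q + 1) % l.length]'(Nat.mod_lt _ (Nat.zero_lt_of_lt hq)), 0))
    (i : ℕ) (hi : i < (triList l).length) :
    P (triList l)[i] ((triList l)[(i + 1) % (triList l).length]'(Nat.mod_lt _ (Nat.zero_lt_of_lt hi))) := by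
  have hL : (triList l).length = 3 * l.length := length_triList l
  have hi3 : i < 3 * l.length := hL ▸ hi
  set q := i / 3 with hq
  have hql : q < l.length := by omega
  have hmem : l[q] ∈ l := List.getElem_mem _
  rw [getElem_triList, getElem_triList]
  rcases (by omega : i % 3 = 0 ∨ i % 3 = 1 ∨ i % 3 = 2) with h0 | h1 | h2
  · -- `(v,0) → (v,1)`
    have hs : (i + 1) % (triList l).length = i + 1 := by rw [hL]; exact Nat.mod_eq_of_lt (by omega)
    have ht : tag3 i = 0 := (tag3_eq_zero_iff i).2 h0
    have ht' : tag3 ((i + 1) % (triList l).length) = 1 := by rw [hs, tag3_eq_one_iff]; omega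
    have hd : (i + 1) % (triList l).length / 3 = q := by rw [hs]; omega
    simp only [ht, ht', hd]
    exact h01 _ hmem
  · -- `(v,1) → (v,2)`
    have hs : (i + 1) % (triList l).length = i + 1 := by rw [hL]; exact Nat.mod_eq_of_lt (by omega)
    have ht : tag3 i = 1 := (tag3_eq_one_iff i).2 h1
    have ht' : tag3 ((i + 1) % (triList l).length) = 2 := by rw [hs, tag3_eq_two_iff]; omega
    have hd : (i + 1) % (triList l).length / 3 = q := by rw [hs]; omega
    simp only [ht, ht', hd]
    exact h12 _ hmem
  · -- `(l_q,2) → (l_{q+1},0)`, including the wrap-around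
    have ht : tag3 i = 2 := (tag3_eq_two_iff i).2 h2
    have hi1 : i + 1 = 3 * (q + 1) := by omega
    have hs : (i + 1) % (triList l).length = 3 * ((q + 1) % l.length) := by
      rw [hL, hi1, Nat.mul_mod_mul_left]
    have ht' : tag3 ((i + 1) % (triList l).length) = 0 := by
      rw [hs, tag3_eq_zero_iff]; omega
    have hd : (i + 1) % (triList l).length / 3 = (q + 1) % l.length := by rw [hs]; omega
    simp only [ht, ht', hd]
    exact h20 q hql

/-- **Forward direction**: tripling a directed Hamiltonian cycle of `A` gives a Hamiltonian cycle
of the split graph. [cite: Sipser2012, Thm. 7.55 (proof, first direction)] -/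
theorem isHamCycleListing_triList [DecidableEq V] {l : List V} (hl : IsHamCycleListing A l) :
    IsHamCycleListing (splitGraph A).Adj (triList l) := by
  refine ⟨nodup_triList hl.nodup, fun ⟨v, r⟩ => mem_triList (hl.mem v) r, ?_⟩
  exact triList_cyclic (splitGraph A).Adj (fun v _ => splitGraph_adj_in_mid A v)
    (fun v _ => splitGraph_adj_mid_out A v) (fun q hq => splitGraph_adj_out_in A (hl.rel q hq))

/-! ### Backward direction: reading a directed cycle off a tour of the split graph -/

section Backward

variable {A}
variable [DecidableEq V] {T : Finset (Sym2 (V × Fin 3))}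

/-- A Hamiltonian graph on at least two vertices carries a tour (the edge set of a Hamiltonian
cycle) inside its edge set. [folklore] -/
theorem exists_isTourOn_of_isHamiltonian {W : Type*} [Fintype W] [DecidableEq W]
    {G : _root_.SimpleGraph W} (hG : G.IsHamiltonian) (h1 : Fintype.card W ≠ 1) :
    ∃ T : Finset (Sym2 W), IsTourOn T ∧ ∀ e ∈ T, e ∈ G.edgeSet := by
  obtain ⟨a, p, hp⟩ := hG h1
  refine ⟨p.edges.toFinset, ⟨a, p.mapLe le_top, hp.map (f := Hom.ofLE le_top) bijective_id, ?_⟩,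
    fun e he => p.edges_subset_edgeSet (List.mem_toFinset.1 he)⟩
  rw [Walk.edges_mapLe_eq_edges]

variable (hT : IsTourOn T) (hTG : ∀ e ∈ T, e ∈ (splitGraph A).edgeSet)
include hT hTG

/-- Both edges at `v_mid` are tour edges. [cite: Sipser2012, Thm. 7.55 (proof: "no other way is
available to include u_mid")] -/
theorem mid_edges_mem (v : V) : s((v, 1), (v, 0)) ∈ T ∧ s((v, 1), (v, 2)) ∈ T :=
  hT.both_mem hTG fun y hy => (splitGraph_adj_mid_iff A v y).1 hy

/-- **The successor**: the second tour edge at `v_out` goes to some `w_in` with `A v w`.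
[cite: Sipser2012, Thm. 7.55 (proof: "the next node must be u_j_in for some j")] -/
theorem exists_next (v : V) : ∃ w, A v w ∧ s((v, 2), (w, 0)) ∈ T := by
  have h2 := hT.card_filter_mem (v, 2)
  obtain ⟨e₁, e₂, hne, heq⟩ := Finset.card_eq_two.1 h2
  have hm₁ : e₁ ∈ T.filter fun e => (v, 2) ∈ e := by rw [heq]; simp
  have hm₂ : e₂ ∈ T.filter fun e => (v, 2) ∈ e := by rw [heq]; simp
  rw [mem_filter] at hm₁ hm₂
  -- one of them is not the edge to `v_mid`
  obtain ⟨e, heT, hve, hem⟩ : ∃ e ∈ T, (v, 2) ∈ e ∧ e ≠ s((v, 2), (v, 1)) := by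
    by_cases h : e₁ = s((v, 2), (v, 1))
    · exact ⟨e₂, hm₂.1, hm₂.2, fun h' => hne (h.trans h'.symm)⟩
    · exact ⟨e₁, hm₁.1, hm₁.2, h⟩
  obtain ⟨y, hy, rfl⟩ := edge_eq_of_supported hTG heT hve
  rcases (splitGraph_adj_out_iff A v y).1 hy with rfl | ⟨w, rfl, hw⟩
  · exact absurd rfl hem
  · exact ⟨w, hw, heT⟩

/-- Symmetrically, the second tour edge at `v_in` comes from some `u_out` with `A u v`.
[cite: Sipser2012, Thm. 7.55 (proof)] -/
theorem exists_prev (v : V) : ∃ u, A u v ∧ s((u, 2), (v, 0)) ∈ T := by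
  have h2 := hT.card_filter_mem (v, 0)
  obtain ⟨e₁, e₂, hne, heq⟩ := Finset.card_eq_two.1 h2
  have hm₁ : e₁ ∈ T.filter fun e => (v, 0) ∈ e := by rw [heq]; simp
  have hm₂ : e₂ ∈ T.filter fun e => (v, 0) ∈ e := by rw [heq]; simp
  rw [mem_filter] at hm₁ hm₂
  obtain ⟨e, heT, hve, hem⟩ : ∃ e ∈ T, (v, 0) ∈ e ∧ e ≠ s((v, 0), (v, 1)) := by
    by_cases h : e₁ = s((v, 0), (v, 1))
    · exact ⟨e₂, hm₂.1, hm₂.2, fun h' => hne (h.trans h'.symm)⟩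
    · exact ⟨e₁, hm₁.1, hm₁.2, h⟩
  obtain ⟨y, hy, rfl⟩ := edge_eq_of_supported hTG heT hve
  rcases (splitGraph_adj_in_iff A v y).1 hy with rfl | ⟨u, rfl, hu⟩
  · exact absurd rfl hem
  · exact ⟨u, hu, by rw [Sym2.eq_swap]; exact heT⟩

/-- **Uniqueness at `v_in`**: two tour edges `{u_out, v_in}`, `{u'_out, v_in}` coincide (the
third edge at `v_in` is the forced `{v_in, v_mid}`). [cite: Sipser2012, Thm. 7.55 (proof)] -/
theorem prev_unique {v u u' : V} (hu : s((u, 2), (v, 0)) ∈ T) (hu' : s((u', 2), (v, 0)) ∈ T) :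
    u = u' := by
  by_contra hne
  have hmid : s((v, 1), (v, 0)) ∈ T := (mid_edges_mem hT hTG v).1
  have h1 : s(((u, 2) : V × Fin 3), (v, 0)) ≠ s((v, 1), (v, 0)) := fun h => by
    have := Sym2.congr_left.1 h; simp at this
  rcases hT.eq_or_eq_of_mem hu hmid h1 (Sym2.mem_mk_right _ _) (Sym2.mem_mk_right _ _) hu'
    (Sym2.mem_mk_right _ _) with h | h
  · exact hne (by have := Sym2.congr_left.1 h; simpa using this.symm)
  · have := Sym2.congr_left.1 h; simp at this

/-- The successor function of the tour (a choice of the `w` of `exists_next`). [folklore] -/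
noncomputable def next (v : V) : V := Classical.choose (exists_next hT hTG v)

/-- The defining property of the successor: an arc of `A` and a tour edge `{v_out, next v_in}`.
[cite: Sipser2012, Thm. 7.55 (proof)] -/
theorem next_spec (v : V) : A v (next hT hTG v) ∧ s((v, 2), (next hT hTG v, 0)) ∈ T :=
  Classical.choose_spec (exists_next hT hTG v)

/-- The successor function is injective. [cite: Sipser2012, Thm. 7.55 (proof)] -/
theorem next_injective : Injective (next hT hTG) := fun v v' h =>
  prev_unique hT hTG (next_spec hT hTG v).2 (h ▸ (next_spec hT hTG v').2)

/-- The orbit of `v₀` under the successor, as a list. [folklore] -/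
noncomputable def orbitList (v₀ : V) : List V :=
  (List.range (minimalPeriod (next hT hTG) v₀)).map fun i => (next hT hTG)^[i] v₀

/-- The orbit list has length the minimal period. [folklore] -/
theorem length_orbitList (v₀ : V) :
    (orbitList hT hTG v₀).length = minimalPeriod (next hT hTG) v₀ := by
  simp [orbitList]

/-- Entry `i` of the orbit list is the `i`-th iterate. [folklore] -/
theorem getElem_orbitList (v₀ : V) (i : ℕ) (hi : i < (orbitList hT hTG v₀).length) :
    (orbitList hT hTG v₀)[i] = (next hT hTG)^[i] v₀ := by
  simp [orbitList]

/-- The successor being a permutation of a finite type, every vertex is periodic. [folklore] -/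
theorem minimalPeriod_pos [Fintype V] (v₀ : V) : 0 < minimalPeriod (next hT hTG) v₀ :=
  minimalPeriod_pos_of_mem_periodicPts ((next_injective hT hTG).mem_periodicPts v₀)

/-- The orbit list has no duplicates (iterates below the minimal period are distinct).
[folklore] -/
theorem nodup_orbitList (v₀ : V) : (orbitList hT hTG v₀).Nodup := by
  rw [orbitList, List.nodup_map_iff_inj_on List.nodup_range]
  intro i hi j hj h
  rw [List.mem_range] at hi hj
  exact (iterate_eq_iterate_iff_of_lt_minimalPeriod hi hj).1 h

/-- The orbit list is cyclically closed under the successor. [folklore] -/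
theorem orbitList_succ (v₀ : V) (q : ℕ) (hq : q < (orbitList hT hTG v₀).length) :
    (orbitList hT hTG v₀)[(q + 1) % (orbitList hT hTG v₀).length]'(Nat.mod_lt _ (Nat.zero_lt_of_lt hq)) =
      next hT hTG (orbitList hT hTG v₀)[q] := by
  rw [getElem_orbitList, getElem_orbitList]
  rw [length_orbitList] at hq ⊢
  have key : (next hT hTG)^[(q + 1) % minimalPeriod (next hT hTG) v₀] v₀ = (next hT hTG)^[q + 1] v₀ := by
    by_cases h : q + 1 < minimalPeriod (next hT hTG) v₀
    · rw [Nat.mod_eq_of_lt h]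
    · have he : q + 1 = minimalPeriod (next hT hTG) v₀ := by omega
      rw [he, Nat.mod_self, iterate_minimalPeriod]
      rfl
  rw [key, iterate_succ_apply']

/-- All edges of the tripled orbit are tour edges. [cite: Sipser2012, Thm. 7.55 (proof)] -/
theorem cycEdges_triList_orbitList_subset (v₀ : V) : cycEdges (triList (orbitList hT hTG v₀)) ⊆ T := by
  intro e he
  obtain ⟨i, hi, rfl⟩ := mem_cycEdges_iff.1 he
  refine triList_cyclic (fun x y => s(x, y) ∈ T) (fun v _ => ?_) (fun v _ => ?_) (fun q hq => ?_) i hi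
  · rw [Sym2.eq_swap]; exact (mid_edges_mem hT hTG v).1
  · exact (mid_edges_mem hT hTG v).2
  · rw [orbitList_succ hT hTG v₀ q hq]
    exact (next_spec hT hTG _).2

/-- **The orbit is everything** (subtour elimination). [cite: Sipser2012, Thm. 7.55 (proof)] -/
theorem length_orbitList_eq_card [Fintype V] (v₀ : V) : (orbitList hT hTG v₀).length = Fintype.card V := by
  have hle : (orbitList hT hTG v₀).length ≤ Fintype.card V :=
    (nodup_orbitList hT hTG v₀).length_le_card
  by_contra hne
  have hlt : (orbitList hT hTG v₀).length < Fintype.card V := lt_of_le_of_ne hle hne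
  have hpos := minimalPeriod_pos hT hTG v₀
  refine hT.not_cycEdges_subset (nodup_triList (nodup_orbitList hT hTG v₀)) ?_ ?_
    (cycEdges_triList_orbitList_subset hT hTG v₀)
  · rw [length_triList, length_orbitList]; omega
  · rw [length_triList, Fintype.card_prod, Fintype.card_fin]; omega

/-- **Backward direction**: the orbit of the successor map of a tour of the split graph is a
directed Hamiltonian cycle of `A`. [cite: Sipser2012, Thm. 7.55 (proof, second direction)] -/
theorem isHamCycleListing_orbitList [Fintype V] (v₀ : V) : IsHamCycleListing A (orbitList hT hTG v₀) := by
  have hnd := nodup_orbitList hT hTG v₀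
  have hlen := length_orbitList_eq_card hT hTG v₀
  refine ⟨hnd, fun v => ?_, fun i hi => ?_⟩
  · -- a duplicate-free list of full length contains every vertex
    have huniv : (orbitList hT hTG v₀).toFinset = univ :=
      eq_univ_of_card _ (by rw [List.toFinset_card_of_nodup hnd, hlen])
    exact List.mem_toFinset.1 (huniv ▸ mem_univ v)
  · rw [orbitList_succ hT hTG v₀ i hi]
    exact (next_spec hT hTG _).1

end Backward

/-! ### The equivalence -/

/-- **Sipser's Theorem 7.55 / Karp's DIRECTED HAMILTON CIRCUIT ∝ HAMILTON CIRCUIT, combinatorial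
content.** The split graph of a digraph `A` on a finite vertex set is Hamiltonian iff `A` has a
directed Hamiltonian cycle (a nonempty cyclic listing of all vertices along arcs of `A`; for one
vertex `v` this means the loop `A v v`, for two vertices `u, v` the 2-cycle `A u v ∧ A v u`).
[cite: Sipser2012, Thm. 7.55] [cite: Karp1972, Main Theorem (problems 9, 10)] -/
theorem isHamiltonian_splitGraph_iff [Fintype V] [DecidableEq V] (A : V → V → Prop) :
    (splitGraph A).IsHamiltonian ↔ ∃ l : List V, l ≠ [] ∧ IsHamCycleListing A l := by
  constructor
  · intro hG
    have hne : Nonempty V := by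
      by_contra h
      rw [not_nonempty_iff] at h
      exact not_isHamiltonian_of_isEmpty hG
    obtain ⟨v₀⟩ := hne
    have h1 : Fintype.card (V × Fin 3) ≠ 1 := by
      rw [Fintype.card_prod, Fintype.card_fin]; omega
    obtain ⟨T, hT, hTG⟩ := exists_isTourOn_of_isHamiltonian hG h1
    refine ⟨orbitList hT hTG v₀, ?_, isHamCycleListing_orbitList hT hTG v₀⟩
    rw [← List.length_pos_iff, length_orbitList]
    exact minimalPeriod_pos hT hTG v₀
  · rintro ⟨l, hl0, hl⟩
    refine (isHamCycleListing_triList A hl).isHamiltonian ?_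
    rw [length_triList]
    have := List.length_pos_iff.2 hl0
    omega

end Literature.Combinatorics.SimpleGraph
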